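import Summits.QuantumFields.BalabanUV.Beta.FP.PerfectObjectsT

/-!
# `BalabanUV.Beta.FP.PerfectJetLetters` — road «FP» for binder row D1, `RESIDUAL-FP.md` §9 ROW #4 «JET LETTERS» (owner, gen 10): THE LETTERS OF THE PERFECT
# (LIMIT) STENCILS AND BI-VERTEX TABLES — localisation AND block covariance — FOLLOW BY NAME FROM FINITE-`j` ROWS: uniform localisation + all-scales
# deviations (X1m-S∕W, (CONV-C) currency) and the finite-`j` block covariance of the members; covariance passes to the constructed limit UNCONDITIONALLY

HONEST DEPENDENCY (page 1, mandatory): continuum YM on T⁴ ⇐ BetaPertH ∧ nine spine estimates (0/9 proved); BetaPertH ⇐ (D1) ∧ (D4) ∧ CAP+tail;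
G-an2-4 gates asym, D1 and NE2/3/4.  HONEST FRAMING (cell contract, verbatim): «discharging `BetaPertH` makes Bałaban's UV stability UNCONDITIONAL —
a real constructive-QFT result; it is NOT the continuum limit and NOT the Clay problem.»  THIS MODULE is [folklore] bookkeeping about asym1's ENTRYWISE
CONSTRUCTED LIMITS (`HessKerDressedLimit.limMKerOf∕limStOf∕limTabOf`, `CauchyRate.lim` per entry): (i) an identity that holds member by member between
ENTRIES — such as covariance under lattice translations, `S_j κ (u + v) = shiftK (−v) (S_j κ u)` — holds for the constructed limits WITH NO CONVERGENCE
HYPOTHESIS (both sides are `lim` of literally the same real sequence); (ii) localisation passes to the limit by asym1's closure lemmas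
(`locStencil_limStOf`, `biLoc_limMKerOf`).  No `def`, no `def … : Prop`, nothing cited, 0 sorry; the ROWS (uniform `LocStencil`∕`BiLoc` + all-scales
deviations with `θ < 1`: X1m-S∕W — at `m = 1` the (CONV-C) S∕W slots of row G-an2-4, for `m ≥ 2` our (j, m)-families «not in print») and the finite-`j`
block covariance of the literal's (dressed) tables are DISPLAYED HYPOTHESES, asserted for no object of Bałaban's.  0∕4 row-D1 binders; NOT X1, NOT row #4 for
the literal, NOT (ASYMP), NOT D1, NOT BetaPertH, NOT continuum, NOT Clay.  «not in print; our bookkeeping».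

ABSOLUTE RULE (cell charter, verbatim): «No internally-minted statement may enter as a cited fact. Every hypothesis is either kernel-proved in this package or a
verbatim quotation of a PUBLISHED theorem with page reference. The manuscript(s) under audit are NOT citable for their own disputed steps — they are the thing
under adjudication; programme-internal (2001/route/tribunal) claims are never citable.»

WHY.  The (LEDGER) skeleton's LEFT instance (`RoadAsympEndLeft.hasym_PiBF_of_sliceLedger_left`, joined to the wall by `RoadLeftAssembly`) displays, per `m ≥ 1`,
the jet letters `hSp` (∃ Cs δs > 0, `LocStencil (SPerfOf … S m) Cs δs` ∧ `(Lc^m)ℤ⁴`-covariance) and `hWf` (∃ C2 δ2 > 0, fine-site bi-localisation of every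
`Wf m κ′ u l′ u′` ∧ covariance) of the PERFECT jets.  This file reduces both, BY NAME, to rows on the FINITE-`j` unit-rescaled members — the currency in which
suppliers (an2∕an1∕gan24) state their estimates — so that row #4 of the census reads «⟸ X1m-S∕W rows (EXT) + finite-`j` block covariance (literal property)».

CONTENT.
* §1 [folklore] **`limMKerOf_shiftK`**, **`limStOf_cov_of_members`**, **`limTabOf_cov_of_members`** — covariance (any index shift `v`, any kernel shift `w`)
  passes from the members to the constructed limits, unconditionally (`rfl`-level: `lim` of equal sequences).
* §2 [folklore] **`unitS_cov`**, **`unitW_cov`** — the leg-unit rescalings (`HessKerDressedUnits.unitS∕unitW`, fibrewise) commute with site shifts.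
* §3 [folklore] **`sPerf_letters_of_rows`** — G5's `hSp` letter VERBATIM for `SPerfOf sf sm S m`, every `m ≥ 1`, from: uniform `LocStencil` rows + all-scales
  deviations (`θ m < 1`, `0 < δs m`) of `j ↦ unitS (sf j) (sm j) (S j m)` and the `(Lc^m)ℤ⁴`-covariance of every RAW member `S j m`.
* §4 [folklore] **`wfPerf_letters_of_rows`** — G5's `hWf` letter VERBATIM for `Wf m := limTabOf (j ↦ unitW (sf j) (sm j) (Wf0 j m))`, from fine-site `BiLoc` rows +
  deviations + covariance of the raw members `Wf0 j m`.
Provenance: road FP OWNER b2b-balaban-beta-d1-p3 gen 10 (prover-b2b-balaban-beta-d1-p3-g10-0), 2026-08-21, row #4.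
-/

noncomputable section

namespace Summit.QuantumFields.BalabanUV.Beta.FP.PerfectJetLetters

open Literature.MathematicalPhysics.QuantumFieldTheory.Balaban1983to89
open Literature.MathematicalPhysics.QuantumFieldTheory.Balaban1983to89.Beta
open ExpKernelCalculus (Site MKer BiLoc shiftK)
open OneStepResolventKernel (Fib LocStencil)
open RateCertificate (CauchyRate)
open HessKerDressedLimit (limMKerOf limStOf limTabOf limMKerOf_apply limStOf_apply limTabOf_apply locStencil_limStOf biLoc_limMKerOf)
open Summit.QuantumFields.BalabanUV.Beta.HessKerDressedUnits (unitS unitW unitS_apply unitW_apply)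
open Summit.QuantumFields.BalabanUV.Beta.FP.PerfectObjectsT (SPerfOf WPerfOf)

/-! ## §1 Covariance passes to the constructed limits, unconditionally -/

section Cov

variable {D : ℕ} {F : Type*}

/-- [folklore] **THE CONSTRUCTED LIMIT COMMUTES WITH SITE SHIFTS**: `limMKerOf (j ↦ shiftK v (K j)) = shiftK v (limMKerOf K)` — both sides are, entry by
entry, `lim_j K_j (x + v) (y + v) a b`.  No convergence hypothesis. -/
theorem limMKerOf_shiftK (K : ℕ → MKer D F) (v : Site D) : limMKerOf (fun j => shiftK v (K j)) = shiftK v (limMKerOf K) := rfl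

/-- [folklore] **COVARIANCE OF STENCIL TABLES PASSES TO THE CONSTRUCTED LIMIT**, unconditionally: if every member satisfies
`S_j κ (u + v) = shiftK w (S_j κ u)` (for some index shift `v` and kernel shift `w`), so does `limStOf S`. -/
theorem limStOf_cov_of_members {ι κ₀ : Type*} [Add κ₀] (S : ℕ → ι → κ₀ → MKer D F) {κ : ι} {u v : κ₀} {w : Site D}
    (h : ∀ j, S j κ (u + v) = shiftK w (S j κ u)) : limStOf S κ (u + v) = shiftK w (limStOf S κ u) := by
  rw [limStOf_apply, limStOf_apply, ← limMKerOf_shiftK]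
  exact congrArg limMKerOf (funext h)

/-- [folklore] **COVARIANCE OF SECOND-ORDER TABLES PASSES TO THE CONSTRUCTED LIMIT**, unconditionally. -/
theorem limTabOf_cov_of_members {ι₁ κ₁ ι₂ κ₂ : Type*} [Add κ₁] [Add κ₂] (W : ℕ → ι₁ → κ₁ → ι₂ → κ₂ → MKer D F)
    {μ : ι₁} {y v : κ₁} {ν : ι₂} {y' v' : κ₂} {w : Site D}
    (h : ∀ j, W j μ (y + v) ν (y' + v') = shiftK w (W j μ y ν y')) : limTabOf W μ (y + v) ν (y' + v') = shiftK w (limTabOf W μ y ν y') := by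
  rw [limTabOf_apply, limTabOf_apply, ← limMKerOf_shiftK]
  exact congrArg limMKerOf (funext h)

end Cov

/-! ## §2 The leg-unit rescalings commute with site shifts -/

section Units

variable {d : ℕ}

/-- [folklore] **`unitS` PRESERVES COVARIANCE**: `S κ (u + v) = shiftK w (S κ u)` ⟹ `unitS sf sm S κ (u + v) = shiftK w (unitS sf sm S κ u)`. -/
theorem unitS_cov (sf sm : ℝ) {S : Fin (d + 1) → (Fin (d + 1) → ℤ) → MKer (d + 1) (Fib d)} {κ : Fin (d + 1)} {u v : Fin (d + 1) → ℤ}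
    {w : Site (d + 1)} (h : S κ (u + v) = shiftK w (S κ u)) : unitS sf sm S κ (u + v) = shiftK w (unitS sf sm S κ u) := by
  funext x y a b
  simp only [unitS_apply, shiftK, h]

/-- [folklore] **`unitW` PRESERVES COVARIANCE**: `W μ (y + v) ν (y' + v') = shiftK w (W μ y ν y')` ⟹ the same for `unitW sf sm W`. -/
theorem unitW_cov (sf sm : ℝ) {W : Fin (d + 1) → (Fin (d + 1) → ℤ) → Fin (d + 1) → (Fin (d + 1) → ℤ) → MKer (d + 1) (Fib d)}
    {μ ν : Fin (d + 1)} {y v y' v' : Fin (d + 1) → ℤ} {w : Site (d + 1)} (h : W μ (y + v) ν (y' + v') = shiftK w (W μ y ν y')) :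
    unitW sf sm W μ (y + v) ν (y' + v') = shiftK w (unitW sf sm W μ y ν y') := by
  funext x z a b
  simp only [unitW_apply, shiftK, h]

end Units

/-! ## §3 The jet letters of the perfect stencils from rows -/

section Stencils

variable {d Lc : ℕ} (sf sm : ℕ → ℝ) (S : ℕ → ℕ → Fin (d + 1) → (Fin (d + 1) → ℤ) → MKer (d + 1) (Fib d))

/-- [folklore] **LOCALISATION OF THE PERFECT STENCILS FROM ROWS** (one `m`): a `j`-uniform `LocStencil` bound on the unit-rescaled members and all-scales
deviations with `θ < 1` give `LocStencil (SPerfOf sf sm S m) Cs δ'` — SAME constant and rate (asym1's `locStencil_limStOf`). -/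
theorem locStencil_sPerf_of_rows (m : ℕ) {Cs c δ δ' θ : ℝ} (hS : ∀ j, LocStencil (unitS (sf j) (sm j) (S j m)) Cs δ')
    (hSall : ∀ k j, LocStencil (unitS (sf (k + j)) (sm (k + j)) (S (k + j) m) - unitS (sf k) (sm k) (S k m)) (c * θ ^ k) δ) (hθ1 : θ < 1) :
    LocStencil (SPerfOf sf sm S m) Cs δ' :=
  locStencil_limStOf (S := fun j => unitS (sf j) (sm j) (S j m)) hS hSall hθ1

/-- [folklore] **BLOCK COVARIANCE OF THE PERFECT STENCILS FROM THAT OF THE RAW MEMBERS** (one `m`, block `N`), unconditionally: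
`S j m κ (u + N•t) = shiftK (−N•t) (S j m κ u)` for every `j` ⟹ the same for `SPerfOf sf sm S m`. -/
theorem sPerf_cov_of_members (m : ℕ) (N : ℤ)
    (hcov : ∀ j κ (u t : Fin (d + 1) → ℤ), S j m κ (u + N • t) = shiftK (-(N • t)) (S j m κ u)) (κ : Fin (d + 1)) (u t : Fin (d + 1) → ℤ) :
    SPerfOf sf sm S m κ (u + N • t) = shiftK (-(N • t)) (SPerfOf sf sm S m κ u) :=
  limStOf_cov_of_members (S := fun j => unitS (sf j) (sm j) (S j m)) fun j => unitS_cov (sf j) (sm j) (hcov j κ u t)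

/-- [folklore] **ROW #4, STENCIL HALF — THE (LEDGER) SKELETON's LETTER `hSp` FOR THE PERFECT STENCILS, FROM ROWS.**  For every `m ≥ 1`: uniform `LocStencil`
rows (`Cs m`, `δs m > 0`) and all-scales deviations (`cS m`, `θ m < 1`) of the unit-rescaled (j, m)-members `unitS (sf j) (sm j) (S j m)` (X1m-S; at `m = 1` the
(CONV-C) S-slot of row G-an2-4 — HYPOTHESES), and the `(Lc^m)ℤ`-block covariance of every raw member `S j m` (a finite-`j` algebraic property of the literal's
tables — HYPOTHESIS) ⟹ `∃ Cs δs, 0 < δs ∧ LocStencil (SPerfOf sf sm S m) Cs δs ∧ ∀ κ u t, SPerfOf … m κ (u + (Lc^m)•t) = shiftK (−(Lc^m)•t) (SPerfOf … m κ u)` —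
LITERALLY the binder `hSp` of `RoadLeftAssembly.d1Drift_left_of_sliceLedger` ∕ `hS` of `RoadAsympEndLeft.hasym_PiBF_of_sliceLedger_left` at `S m := SPerfOf … m`. -/
theorem sPerf_letters_of_rows {Cs cS δs θ : ℕ → ℝ}
    (hS : ∀ m : ℕ, 1 ≤ m → ∀ j, LocStencil (unitS (sf j) (sm j) (S j m)) (Cs m) (δs m))
    (hSall : ∀ m : ℕ, 1 ≤ m → ∀ k j,
      LocStencil (unitS (sf (k + j)) (sm (k + j)) (S (k + j) m) - unitS (sf k) (sm k) (S k m)) (cS m * θ m ^ k) (δs m))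
    (hθ1 : ∀ m : ℕ, 1 ≤ m → θ m < 1) (hδs : ∀ m : ℕ, 1 ≤ m → 0 < δs m)
    (hcov : ∀ m : ℕ, 1 ≤ m → ∀ j κ (u t : Fin (d + 1) → ℤ),
      S j m κ (u + ((Lc ^ m : ℕ) : ℤ) • t) = shiftK (-(((Lc ^ m : ℕ) : ℤ) • t)) (S j m κ u)) :
    ∀ m : ℕ, 1 ≤ m → ∃ Cs' δs' : ℝ, 0 < δs' ∧ LocStencil (SPerfOf sf sm S m) Cs' δs' ∧
      ∀ κ u t, SPerfOf sf sm S m κ (u + ((Lc ^ m : ℕ) : ℤ) • t) = shiftK (-(((Lc ^ m : ℕ) : ℤ) • t)) (SPerfOf sf sm S m κ u) :=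
  fun m hm => ⟨Cs m, δs m, hδs m hm, locStencil_sPerf_of_rows sf sm S m (hS m hm) (hSall m hm) (hθ1 m hm),
    sPerf_cov_of_members sf sm S m _ (hcov m hm)⟩

end Stencils

/-! ## §4 The jet letters of the perfect bi-vertex tables from rows -/

section Tables

variable {d Lc : ℕ} (sf sm : ℕ → ℝ)
  (Wf0 : ℕ → ℕ → Fin (d + 1) → (Fin (d + 1) → ℤ) → Fin (d + 1) → (Fin (d + 1) → ℤ) → MKer (d + 1) (Fib d))

/-- [folklore] **FINE-SITE BI-LOCALISATION OF THE PERFECT BI-VERTEX TABLES FROM ROWS** (one `m`, one index `(κ′, u, l′, u′)`): a `j`-uniform `BiLoc … u u′`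
bound on the unit-rescaled members and all-scales deviations with `θ < 1` ⟹ the same bound for `limTabOf (j ↦ unitW (sf j) (sm j) (Wf0 j m)) κ′ u l′ u′`
(asym1's `biLoc_limMKerOf`). -/
theorem biLoc_wfPerf_of_rows (m : ℕ) {C2 c δ δ' θ : ℝ} (κ' : Fin (d + 1)) (u : Fin (d + 1) → ℤ) (l' : Fin (d + 1)) (u' : Fin (d + 1) → ℤ)
    (hW : ∀ j, BiLoc (unitW (sf j) (sm j) (Wf0 j m) κ' u l' u') u u' C2 δ')
    (hWall : ∀ k j, BiLoc (unitW (sf (k + j)) (sm (k + j)) (Wf0 (k + j) m) κ' u l' u' - unitW (sf k) (sm k) (Wf0 k m) κ' u l' u') u u'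
      (c * θ ^ k) δ) (hθ1 : θ < 1) :
    BiLoc (limTabOf (fun j => unitW (sf j) (sm j) (Wf0 j m)) κ' u l' u') u u' C2 δ' := by
  rw [limTabOf_apply]
  exact biLoc_limMKerOf (T := fun j => unitW (sf j) (sm j) (Wf0 j m) κ' u l' u') hW hWall hθ1

/-- [folklore] **BLOCK COVARIANCE OF THE PERFECT BI-VERTEX TABLES FROM THAT OF THE RAW MEMBERS** (one `m`, block `N`), unconditionally. -/
theorem wfPerf_cov_of_members (m : ℕ) (N : ℤ)
    (hcov : ∀ j κ' (u : Fin (d + 1) → ℤ) l' (u' t : Fin (d + 1) → ℤ),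
      Wf0 j m κ' (u + N • t) l' (u' + N • t) = shiftK (-(N • t)) (Wf0 j m κ' u l' u'))
    (κ' : Fin (d + 1)) (u : Fin (d + 1) → ℤ) (l' : Fin (d + 1)) (u' t : Fin (d + 1) → ℤ) :
    limTabOf (fun j => unitW (sf j) (sm j) (Wf0 j m)) κ' (u + N • t) l' (u' + N • t) =
      shiftK (-(N • t)) (limTabOf (fun j => unitW (sf j) (sm j) (Wf0 j m)) κ' u l' u') :=
  limTabOf_cov_of_members (W := fun j => unitW (sf j) (sm j) (Wf0 j m)) fun j => unitW_cov (sf j) (sm j) (hcov j κ' u l' u' t)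

/-- [folklore] **ROW #4, BI-VERTEX HALF — THE (LEDGER) SKELETON's LETTER `hWf` FOR THE PERFECT BI-VERTEX TABLES, FROM ROWS.**  With
`Wf m := limTabOf (j ↦ unitW (sf j) (sm j) (Wf0 j m))` (the constructed unit-limit of a supplied (j, m)-family of bi-vertex tables — the bi-vertex part of
the literal's second-order slot, row #14): for every `m ≥ 1`, INDEX-UNIFORM fine-site `BiLoc` rows (`C2 m`, `δ2 m > 0`) and all-scales deviations (`c2 m`,
`θ m < 1`) of the unit-rescaled members (X1m-W — HYPOTHESES), and the `(Lc^m)ℤ`-block covariance of every raw member (HYPOTHESIS) ⟹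
`∃ C2 δ2, 0 < δ2 ∧ (∀ κ′ u l′ u′, BiLoc (Wf m κ′ u l′ u′) u u′ C2 δ2) ∧ ∀ κ′ u l′ u′ t, Wf m κ′ (u + (Lc^m)•t) l′ (u′ + (Lc^m)•t) = shiftK (−(Lc^m)•t) (Wf m κ′ u l′ u′)`
— LITERALLY the binder `hWf` of `RoadLeftAssembly.d1Drift_left_of_sliceLedger` at that `Wf`. -/
theorem wfPerf_letters_of_rows {C2 c2 δ2 θ : ℕ → ℝ}
    (hW : ∀ m : ℕ, 1 ≤ m → ∀ j κ' (u : Fin (d + 1) → ℤ) l' (u' : Fin (d + 1) → ℤ),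
      BiLoc (unitW (sf j) (sm j) (Wf0 j m) κ' u l' u') u u' (C2 m) (δ2 m))
    (hWall : ∀ m : ℕ, 1 ≤ m → ∀ k j κ' (u : Fin (d + 1) → ℤ) l' (u' : Fin (d + 1) → ℤ),
      BiLoc (unitW (sf (k + j)) (sm (k + j)) (Wf0 (k + j) m) κ' u l' u' - unitW (sf k) (sm k) (Wf0 k m) κ' u l' u') u u'
        (c2 m * θ m ^ k) (δ2 m))
    (hθ1 : ∀ m : ℕ, 1 ≤ m → θ m < 1) (hδ2 : ∀ m : ℕ, 1 ≤ m → 0 < δ2 m)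
    (hcov : ∀ m : ℕ, 1 ≤ m → ∀ j κ' (u : Fin (d + 1) → ℤ) l' (u' t : Fin (d + 1) → ℤ),
      Wf0 j m κ' (u + ((Lc ^ m : ℕ) : ℤ) • t) l' (u' + ((Lc ^ m : ℕ) : ℤ) • t) = shiftK (-(((Lc ^ m : ℕ) : ℤ) • t)) (Wf0 j m κ' u l' u')) :
    ∀ m : ℕ, 1 ≤ m → ∃ C2' δ2' : ℝ, 0 < δ2' ∧
      (∀ κ' (u : Fin (d + 1) → ℤ) l' (u' : Fin (d + 1) → ℤ), BiLoc (limTabOf (fun j => unitW (sf j) (sm j) (Wf0 j m)) κ' u l' u') u u' C2' δ2') ∧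
      ∀ κ' (u : Fin (d + 1) → ℤ) l' (u' t : Fin (d + 1) → ℤ),
        limTabOf (fun j => unitW (sf j) (sm j) (Wf0 j m)) κ' (u + ((Lc ^ m : ℕ) : ℤ) • t) l' (u' + ((Lc ^ m : ℕ) : ℤ) • t)
          = shiftK (-(((Lc ^ m : ℕ) : ℤ) • t)) (limTabOf (fun j => unitW (sf j) (sm j) (Wf0 j m)) κ' u l' u') :=
  fun m hm => ⟨C2 m, δ2 m, hδ2 m hm,
    fun κ' u l' u' => biLoc_wfPerf_of_rows sf sm Wf0 m κ' u l' u' (hW m hm · κ' u l' u') (hWall m hm · · κ' u l' u') (hθ1 m hm),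
    wfPerf_cov_of_members sf sm Wf0 m _ (hcov m hm)⟩

end Tables

end Summit.QuantumFields.BalabanUV.Beta.FP.PerfectJetLetters

end
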